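import Mathlib
import HarnessLib
import Literature.Analysis.FluidPDE.MildSolution
import Literature.Analysis.FluidPDE.NSBoundedMildSmoothing
import Literature.Analysis.FluidPDE.BoundedMildSmoothRemainder
import Literature.Analysis.FluidPDE.KNSSMildGradientBound

/-!
# Route `ExtremiserTransience`, LINE g5-α repair (seat ns-idea-5 g5): GRADIENT Type-I decay for the weak one-slice class

`--supports stmt-NavierStokesRegularity-27823` (`PlateauSliceRigidity`).  Second lemma of the local energy budget (the first, weak incompressibility of
the class, is `…Theorems.ExtremiserTransience.weakClass_isWeaklyDivFree`): a field `W` of the weak class — continuous on `(−∞,0)×ℝ³`, Oseen-mild with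
`ν = 1` from every `s < t < 0`, Type-I decay `√(−t)‖W(t,x)‖ ≤ K` — whose negative-time slices are weakly divergence free has SMOOTH slices obeying the
gradient Type-I rate `(−σ)‖∇W(σ,x)‖ ≤ K₁` for every `σ < 0`, with `K₁ = C·K·√(2(2K²+1))`, `C` the universal constant of KNSS 2009 (4.6)
(`IsKNSSDriftMild.exists_gradient_bound`).  Proof: translate the window `[3σ, σ/2]` to `[0, −5σ/2]` (`oseenDuhamel_translate`), where `‖W‖ ≤ K√2/√(−σ) =: N`;
the clamped translate is drift-mild with zero drift (`isKNSSDriftMild_clamp_of_oseenForward`), so KNSS (4.6) with `k = 1` on the sub-window of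
length `d = (−σ)/(2K²+1)` (`N²d ≤ 1`) ending at the time `−2σ ↔ σ` gives `√d‖∇W(σ)‖ ≤ CN`; smoothness by `smooth_of_oseenForward`.  This is the
input that makes the viscous flux `2∫∫(W·∇W)·∇φ ≲ ρ²KK₁∫(−σ)^{−3/2}dσ` of the budget summable as `σ → −∞`.
HONEST FRAMING: a regularity lemma about a hypothetical class of ancient fields; nothing about Navier–Stokes regularity is proved and no summit is
proved by a line. [cite: KochNadirashviliSereginSverak2009, Prop. 4.1 (4.6) (arXiv:0709.3599 §4 p. 8)]
-/

namespace Summit.NavierStokesRegularity.NavierStokesRegularity.Theorems.ExtremiserTransience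
set_option linter.dupNamespace false

open Set Function MeasureTheory Filter Topology
open scoped RealInnerProductSpace ContDiff
open Literature.Analysis Literature.Analysis.FluidPDE Literature.Analysis.UnboundedOperators

/-- **Gradient Type-I decay and smoothness of weak-class fields with weakly divergence-free slices.** [cite: KochNadirashviliSereginSverak2009, Prop. 4.1 (4.6)] -/
theorem weakClass_gradTypeI_of_divFree (W : ℝ → EuclideanSpace ℝ (Fin 3) → EuclideanSpace ℝ (Fin 3)) (K : ℝ)
    (hcont : ContinuousOn (Function.uncurry W) (Set.Iio (0 : ℝ) ×ˢ Set.univ))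
    (hmild : ∀ s t : ℝ, s < t → t < 0 → ∀ x, W t x =
      Literature.Analysis.FluidPDE.heatFlow (W s) (t - s) x - Literature.Analysis.FluidPDE.oseenDuhamel 1 s W W t x)
    (hdec : ∀ t : ℝ, t < 0 → ∀ x, Real.sqrt (-t) * ‖W t x‖ ≤ K)
    (hdiv : ∀ t < 0, IsWeaklyDivFree (W t)) :
    ∃ K₁ : ℝ, 0 ≤ K₁ ∧ ∀ σ < 0, ContDiff ℝ ∞ (W σ) ∧ ∀ x, (-σ) * ‖fderiv ℝ (W σ) x‖ ≤ K₁ := by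
  obtain ⟨C, hC0, hC⟩ := IsKNSSDriftMild.exists_gradient_bound (E := EuclideanSpace ℝ (Fin 3)) finrank_euclideanSpace_fin
  have hK : 0 ≤ K := by
    have h := hdec (-1) (by norm_num) 0
    have h1 : Real.sqrt (-(-1 : ℝ)) = 1 := by norm_num
    rw [h1, one_mul] at h
    exact (norm_nonneg _).trans h
  refine ⟨C * (K * Real.sqrt 2) * Real.sqrt (2 * K ^ 2 + 1), by positivity, fun σ hσ => ?_⟩
  -- pointwise bound of the slices: `‖W τ y‖ ≤ K/√(−τ)`
  have hbd : ∀ τ < 0, ∀ y, ‖W τ y‖ ≤ K / Real.sqrt (-τ) := by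
    intro τ hτ y
    rw [le_div_iff₀ (Real.sqrt_pos.2 (by linarith)), mul_comm]
    exact hdec τ hτ y
  -- the translated window: `u τ = W (τ + a)`, `a = 3σ`, `S = −5σ/2`, so `[0, S] ↔ [3σ, σ/2]` and `σ ↔ τ⋆ = −2σ`
  set a : ℝ := 3 * σ with ha
  set S : ℝ := -(5 / 2) * σ with hS
  have hSpos : 0 < S := by rw [hS]; linarith
  set N : ℝ := K * Real.sqrt 2 / Real.sqrt (-σ) with hN
  have hsσ : 0 < Real.sqrt (-σ) := Real.sqrt_pos.2 (by linarith)
  have hN0 : 0 ≤ N := by rw [hN]; positivity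
  set u : ℝ → EuclideanSpace ℝ (Fin 3) → EuclideanSpace ℝ (Fin 3) := fun τ => W (τ + a) with hu
  have hneg : ∀ τ ∈ Icc 0 S, τ + a < 0 := by
    intro τ hτ; rw [ha]; have := hτ.2; rw [hS] at this; linarith
  have hle : ∀ τ ∈ Icc 0 S, -σ / 2 ≤ -(τ + a) := by
    intro τ hτ; rw [ha]; have := hτ.2; rw [hS] at this; linarith
  -- continuity of the translate on the closed window
  have hcontu : ContinuousOn (uncurry u) (Icc 0 S ×ˢ univ) := by
    have hmap : Continuous fun p : ℝ × EuclideanSpace ℝ (Fin 3) => (p.1 + a, p.2) := by fun_prop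
    have hinto : MapsTo (fun p : ℝ × EuclideanSpace ℝ (Fin 3) => (p.1 + a, p.2)) (Icc 0 S ×ˢ univ) (Iio 0 ×ˢ univ) :=
      fun p hp => ⟨hneg p.1 hp.1, mem_univ _⟩
    exact (hcont.comp hmap.continuousOn hinto).congr fun p _ => rfl
  -- the bound `N` on the window: `‖W(τ+a)‖ ≤ K/√(−(τ+a)) ≤ K/√(−σ/2) = K√2/√(−σ)`
  have hKu : ∀ τ ∈ Icc 0 S, ∀ x, ‖u τ x‖ ≤ N := by
    intro τ hτ x
    have h1 := hbd (τ + a) (hneg τ hτ) x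
    refine h1.trans ?_
    have hs2 : 0 < Real.sqrt (-σ / 2) := Real.sqrt_pos.2 (by linarith)
    have h2 : K / Real.sqrt (-(τ + a)) ≤ K / Real.sqrt (-σ / 2) :=
      div_le_div_of_nonneg_left hK hs2 (Real.sqrt_le_sqrt (hle τ hτ))
    refine h2.trans (le_of_eq ?_)
    rw [hN]
    have hsq : Real.sqrt (-σ / 2) * Real.sqrt 2 = Real.sqrt (-σ) := by
      rw [← Real.sqrt_mul (by linarith : (0:ℝ) ≤ -σ / 2)]; congr 1; ring
    rw [div_eq_div_iff hs2.ne' hsσ.ne', ← hsq]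
    ring
  have hdivu : ∀ τ ∈ Icc 0 S, IsWeaklyDivFree (u τ) := fun τ hτ => hdiv (τ + a) (hneg τ hτ)
  -- the Oseen-mild identity on the translated window
  have hmildu : ∀ s t : ℝ, 0 ≤ s → s < t → t ≤ S → ∀ x,
      u t x = heatExtension (u s) (t - s) x - oseenDuhamel 1 s u u t x := by
    intro s t hs hst htS x
    have ht0 : t + a < 0 := hneg t ⟨hs.trans hst.le, htS⟩
    have h := hmild (s + a) (t + a) (by linarith) ht0 x
    have hts : t + a - (s + a) = t - s := by ring
    rw [hts, heatFlow_of_pos (W (s + a)) (sub_pos.2 hst)] at h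
    rw [show u t x = W (t + a) x from rfl, h, oseenDuhamel_translate 1 s a W W t x]
  -- KNSS: the clamped translate is drift-mild with zero drift, and its slices in the open window are smooth
  have hV := isKNSSDriftMild_clamp_of_oseenForward hSpos hcontu hKu hdivu hmildu
  obtain ⟨hsm, -, -, -⟩ := smooth_of_oseenForward hSpos hcontu hKu hdivu hmildu
  -- the time `τ⋆ = −2σ ∈ (0, S)` and the sub-window of length `d = (−σ)/(2K²+1)`
  set τs : ℝ := -2 * σ with hτs
  have hτs_mem : τs ∈ Ioo 0 S := by rw [hτs, hS]; constructor <;> linarith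
  set d : ℝ := -σ / (2 * K ^ 2 + 1) with hd
  have hKd : 0 < 2 * K ^ 2 + 1 := by positivity
  have hdpos : 0 < d := by rw [hd]; exact div_pos (by linarith) hKd
  have hdle : d ≤ -σ := by
    rw [hd, div_le_iff₀ hKd]; nlinarith [sq_nonneg K]
  have hs0 : 0 < τs - d := by rw [hτs]; linarith
  have hNd : N ^ 2 * (τs - (τs - d)) ≤ 1 := by
    have h1 : τs - (τs - d) = d := by ring
    rw [h1, hN, div_pow, mul_pow, Real.sq_sqrt (by norm_num : (0:ℝ) ≤ 2), Real.sq_sqrt (by linarith : (0:ℝ) ≤ -σ), hd]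
    rw [div_mul_div_comm, div_le_one (by nlinarith)]
    have : K ^ 2 * 2 * -σ ≤ -σ * (2 * K ^ 2 + 1) := by nlinarith [sq_nonneg K]
    linarith
  have hgrad := hC hV hs0 (by linarith) hτs_mem.2 hNd
  -- identify the clamped slice at `τ⋆` with `W σ`
  have hclamp : max 0 (min τs S) = τs := by
    rw [min_eq_left hτs_mem.2.le, max_eq_right hτs_mem.1.le]
  have hslice : (fun x => u (max 0 (min τs S)) x) = W σ := by
    funext x; rw [hclamp, show u τs x = W (τs + a) x from rfl]; congr 1; rw [hτs, ha]; ring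
  have hστ : τs + a = σ := by rw [hτs, ha]; ring
  refine ⟨?_, fun x => ?_⟩
  · have h := hsm τs hτs_mem
    rw [show u τs = W σ from by funext x; rw [show u τs x = W (τs + a) x from rfl, hστ]] at h
    exact h
  · have h := hgrad x
    rw [hslice, show τs - (τs - d) = d by ring] at h
    -- `√d ‖∇W(σ)x‖ ≤ C N` ⇒ `(−σ)‖∇W(σ)x‖ ≤ C N (−σ)/√d = C K √2 √(2K²+1)`
    have hsd : 0 < Real.sqrt d := Real.sqrt_pos.2 hdpos
    have hd_eq : d ^ (1 / 2 : ℝ) = Real.sqrt d := by rw [Real.sqrt_eq_rpow]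
    rw [hd_eq] at h
    have hσd : -σ = Real.sqrt d * (Real.sqrt d * (2 * K ^ 2 + 1)) := by
      rw [← mul_assoc, Real.mul_self_sqrt hdpos.le, hd]; field_simp
    have hkey : (-σ) * ‖fderiv ℝ (W σ) x‖ = (Real.sqrt d * ‖fderiv ℝ (W σ) x‖) * (Real.sqrt d * (2 * K ^ 2 + 1)) := by
      rw [hσd]; ring
    rw [hkey]
    calc Real.sqrt d * ‖fderiv ℝ (W σ) x‖ * (Real.sqrt d * (2 * K ^ 2 + 1))
        ≤ C * N * (Real.sqrt d * (2 * K ^ 2 + 1)) := mul_le_mul_of_nonneg_right h (by positivity)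
      _ = C * (K * Real.sqrt 2) * (Real.sqrt d * (2 * K ^ 2 + 1) / Real.sqrt (-σ)) := by rw [hN]; ring
      _ ≤ C * (K * Real.sqrt 2) * Real.sqrt (2 * K ^ 2 + 1) := by
          refine mul_le_mul_of_nonneg_left ?_ (by positivity)
          rw [div_le_iff₀ hsσ]
          -- `√d (2K²+1) ≤ √(2K²+1) √(−σ)` since `d (2K²+1) = −σ`
          have hprod : Real.sqrt (2 * K ^ 2 + 1) * Real.sqrt (-σ) = Real.sqrt ((2 * K ^ 2 + 1) * (-σ)) := by
            rw [← Real.sqrt_mul hKd.le]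
          have hdK : d * (2 * K ^ 2 + 1) = -σ := by rw [hd]; field_simp
          have hlhs : Real.sqrt d * (2 * K ^ 2 + 1) = Real.sqrt (d * (2 * K ^ 2 + 1) ^ 2) := by
            rw [Real.sqrt_mul hdpos.le, Real.sqrt_sq hKd.le]
          rw [hprod, hlhs]
          refine Real.sqrt_le_sqrt ?_
          have : d * (2 * K ^ 2 + 1) ^ 2 = (2 * K ^ 2 + 1) * (-σ) := by rw [← hdK]; ring
          rw [this]

end Summit.NavierStokesRegularity.NavierStokesRegularity.Theorems.ExtremiserTransience
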